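import Summits.Ventures.LatticeQCDFlow.Scaling.SectorExactAugmentation

/-!
HONEST FRAMING: exact (Metropolis-corrected) sampling algorithms for lattice gauge theory; figures
of merit are autocorrelation/cost numbers at stated couplings and volumes; no continuum-physics
claim.

# SectorExactStaleSet — THE PRIMORDIAL CONTENT OF THE PERSISTENT HUB DIES AT THE BOOLEAN-STAR RATE WHATEVER `S` IS: THE STALE
# POTENTIAL `Ψ(D) = θ·𝟙{0 ∈ D} + #(D ∖ {0})` OF THE SECTOR-EXACT AUGMENTATION CONTRACTS, `E Ψ' ≤ (1−λ)Ψ` WITH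
# `λ = min{(1−θ)act/m, ((1−t)w_0θ − (1−θ)t)/(K+θ)}`, HENCE `P_{(x,univ)}{D_n ≠ ∅} ≤ ((θ+K)/θ)(1−λ)ⁿ` (lean-2 GEN-30, ours)

Venture-side (OURS).  Cell `lqcd-flow` (pub-lqcd), unit `pub-lqcd-lean-2-g30`, 2026-08-28.  Chapter Q (OPEN-MATH-chapterM item 1 for
SECTOR-EXACT maps on a general finite `S`), file 1b.  Setting of `Scaling/SectorExactAugmentation` (the augmentation `P̂` with `γ = α`, `B = id`;
acceptance floor `a ≤ α_r(z)` for all `r, z`, e.g. `a = min_r min{1, cin_r/cout_r, cout_r/cin_r}`).  The stale potential is carried as the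
hypothesis-equation `Ψ(D) = Σ_k c_k𝟙{k ∈ D}`, `c_0 = θ`, `c_k = 1` (`k ≥ 1`) — the same weights as chapter P's disagreement potential, and the same
drift: a stale cold unit is offered to the hub at rate `≥ ct/m`, accepted with probability `≥ a`, and is worth `θ` there; a stale hub unit escapes at
rate `≤ t` (gain `1−θ`) and dies at the redraw (rate `(1−t)w_0`, loss `θ`).

## What is proved

* `stalePotential_swap`, `stalePotential_erase`, `stalePotential_le`, `stalePotential_ge_of_nonempty`, `stalePotential_eq_hub_add_cold`,
  `sum_entries_stale_ge`;
* **`sectorAug_step_stalePotential_le`** — `Σ_b P̂(a,b)·Ψ(b.2) ≤ (1−λ)·Ψ(a.2)` for every augmented state (`0 < θ ≤ 1`, `(1−θ)t ≤ (1−t)w_0θ`,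
  `a ≥ 0`, multiplicities `≥ c`, ANY row-stochastic cold kernels);
* **`sectorAug_stale_le`** — from `δ_{(x, univ)}`: **`Σ_{(z,D) : D ≠ ∅} λ̂_n(z,D) ≤ ((θ+K)/θ)·(1−λ)ⁿ`**.

Reading (no numerics implied): what is left at time `n` is, up to this geometrically small mass, made of content born at the hub after
time `0`; files 2–3 show that such content is exactly distributed within its sector given the labels.  NOT CLAIMED here: the law (files 4–5).
Literature grade (cell rule): OWN; nothing cited as a fact; no new bib keys.
-/

noncomputable section

open Finset Function
open Literature.Probability.MarkovChains

namespace Summit.Ventures.LatticeQCDFlow.Scaling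

variable {S : Type*} [Fintype S] [DecidableEq S] {K m : ℕ} {μ : Fin (K + 1) → S → ℝ} {M : Fin (K + 1) → S → S → ℝ}
  {w : Fin (K + 1) → ℝ} {t : ℝ}

section StaleSet
variable (κ : Fin m → Fin K) (φ : Fin m → Equiv.Perm S)

/-! ## §3 The stale potential contracts -/

/-- **Locality of `Ψ(D) = Σ_k c_k𝟙{k ∈ D}` under the tag exchange `σ_r`:** `Ψ(σ_r D) = Ψ(D) + θ(𝟙{l∈D} − 𝟙{0∈D}) + (𝟙{0∈D} − 𝟙{l∈D})`.
[ours] -/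
theorem stalePotential_swap {θ : ℝ} {Ψ : Finset (Fin (K + 1)) → ℝ}
    (hΨ : ∀ D, Ψ D = ∑ k : Fin (K + 1), (if k = 0 then θ else 1) * (if k ∈ D then (1 : ℝ) else 0))
    (r : Fin m) (D : Finset (Fin (K + 1))) :
    Ψ (D.image (Equiv.swap (0 : Fin (K + 1)) (κ r).succ))
      = Ψ D + θ * ((if (κ r).succ ∈ D then (1 : ℝ) else 0) - (if (0 : Fin (K + 1)) ∈ D then (1 : ℝ) else 0))
        + ((if (0 : Fin (K + 1)) ∈ D then (1 : ℝ) else 0) - (if (κ r).succ ∈ D then (1 : ℝ) else 0)) := by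
  have hl : (0 : Fin (K + 1)) ≠ (κ r).succ := (Fin.succ_ne_zero (κ r)).symm
  rw [hΨ, hΨ]
  have hdiff : ∑ k : Fin (K + 1), (if k = 0 then θ else 1) * (if k ∈ D.image (Equiv.swap (0 : Fin (K + 1)) (κ r).succ) then (1 : ℝ) else 0)
      - ∑ k : Fin (K + 1), (if k = 0 then θ else 1) * (if k ∈ D then (1 : ℝ) else 0)
      = ∑ k : Fin (K + 1), (if k = 0 then θ else 1)
          * ((if k ∈ D.image (Equiv.swap (0 : Fin (K + 1)) (κ r).succ) then (1 : ℝ) else 0) - (if k ∈ D then (1 : ℝ) else 0)) := by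
    rw [← Finset.sum_sub_distrib]; exact sum_congr rfl fun k _ => by ring
  have hsub : ∑ k : Fin (K + 1), (if k = 0 then θ else 1)
          * ((if k ∈ D.image (Equiv.swap (0 : Fin (K + 1)) (κ r).succ) then (1 : ℝ) else 0) - (if k ∈ D then (1 : ℝ) else 0))
      = ∑ k ∈ ({0, (κ r).succ} : Finset (Fin (K + 1))), (if k = 0 then θ else 1)
          * ((if k ∈ D.image (Equiv.swap (0 : Fin (K + 1)) (κ r).succ) then (1 : ℝ) else 0) - (if k ∈ D then (1 : ℝ) else 0)) := by
    symm
    refine Finset.sum_subset (Finset.subset_univ _) fun k _ hk => ?_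
    rw [Finset.mem_insert, Finset.mem_singleton, not_or] at hk
    have hiff : k ∈ D.image (Equiv.swap (0 : Fin (K + 1)) (κ r).succ) ↔ k ∈ D := by
      rw [mem_swapImage_iff κ r D k, Equiv.swap_apply_of_ne_of_ne hk.1 hk.2]
    rw [if_congr hiff rfl rfl]; ring
  have hpair : ∑ k ∈ ({0, (κ r).succ} : Finset (Fin (K + 1))), (if k = 0 then θ else 1)
          * ((if k ∈ D.image (Equiv.swap (0 : Fin (K + 1)) (κ r).succ) then (1 : ℝ) else 0) - (if k ∈ D then (1 : ℝ) else 0))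
      = θ * ((if (κ r).succ ∈ D then (1 : ℝ) else 0) - (if (0 : Fin (K + 1)) ∈ D then (1 : ℝ) else 0))
        + 1 * ((if (0 : Fin (K + 1)) ∈ D then (1 : ℝ) else 0) - (if (κ r).succ ∈ D then (1 : ℝ) else 0)) := by
    have h0iff : (0 : Fin (K + 1)) ∈ D.image (Equiv.swap (0 : Fin (K + 1)) (κ r).succ) ↔ (κ r).succ ∈ D := by
      rw [mem_swapImage_iff κ r D 0, Equiv.swap_apply_left]
    have hliff : (κ r).succ ∈ D.image (Equiv.swap (0 : Fin (K + 1)) (κ r).succ) ↔ (0 : Fin (K + 1)) ∈ D := by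
      rw [mem_swapImage_iff κ r D (κ r).succ, Equiv.swap_apply_right]
    rw [Finset.sum_pair hl, if_pos rfl, if_neg hl.symm, if_congr h0iff rfl rfl, if_congr hliff rfl rfl]
  linarith [hdiff, hsub, hpair]

/-- `Ψ(D ∖ {0}) = Ψ(D) − θ𝟙{0 ∈ D}`. [ours] -/
theorem stalePotential_erase {θ : ℝ} {Ψ : Finset (Fin (K + 1)) → ℝ}
    (hΨ : ∀ D, Ψ D = ∑ k : Fin (K + 1), (if k = 0 then θ else 1) * (if k ∈ D then (1 : ℝ) else 0))
    (D : Finset (Fin (K + 1))) :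
    Ψ (D.erase 0) = Ψ D - θ * (if (0 : Fin (K + 1)) ∈ D then (1 : ℝ) else 0) := by
  rw [hΨ, hΨ]
  have hdiff : ∑ k : Fin (K + 1), (if k = 0 then θ else 1) * (if k ∈ D.erase 0 then (1 : ℝ) else 0)
      - ∑ k : Fin (K + 1), (if k = 0 then θ else 1) * (if k ∈ D then (1 : ℝ) else 0)
      = ∑ k : Fin (K + 1), (if k = 0 then θ else 1) * ((if k ∈ D.erase 0 then (1 : ℝ) else 0) - (if k ∈ D then (1 : ℝ) else 0)) := by
    rw [← Finset.sum_sub_distrib]; exact sum_congr rfl fun k _ => by ring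
  have hsub : ∑ k : Fin (K + 1), (if k = 0 then θ else 1) * ((if k ∈ D.erase 0 then (1 : ℝ) else 0) - (if k ∈ D then (1 : ℝ) else 0))
      = ∑ k ∈ ({0} : Finset (Fin (K + 1))), (if k = 0 then θ else 1)
          * ((if k ∈ D.erase 0 then (1 : ℝ) else 0) - (if k ∈ D then (1 : ℝ) else 0)) := by
    symm
    refine Finset.sum_subset (Finset.subset_univ _) fun k _ hk => ?_
    rw [Finset.mem_singleton] at hk
    have hiff : k ∈ D.erase 0 ↔ k ∈ D := by rw [Finset.mem_erase]; exact and_iff_right hk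
    rw [if_congr hiff rfl rfl]; ring
  rw [Finset.sum_singleton, if_pos rfl] at hsub
  have h0 : (if (0 : Fin (K + 1)) ∈ D.erase 0 then (1 : ℝ) else 0) = 0 := by
    rw [if_neg]; rw [Finset.mem_erase]; exact fun h => h.1 rfl
  rw [h0] at hsub
  linarith [hdiff, hsub]

/-- `0 ≤ Ψ ≤ θ + K`. [ours] -/
theorem stalePotential_le {θ : ℝ} (hθ0 : 0 ≤ θ) {Ψ : Finset (Fin (K + 1)) → ℝ}
    (hΨ : ∀ D, Ψ D = ∑ k : Fin (K + 1), (if k = 0 then θ else 1) * (if k ∈ D then (1 : ℝ) else 0))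
    (D : Finset (Fin (K + 1))) : 0 ≤ Ψ D ∧ Ψ D ≤ θ + K := by
  rw [hΨ, Fin.sum_univ_succ, if_pos rfl]
  simp_rw [if_neg (Fin.succ_ne_zero _), one_mul]
  refine ⟨add_nonneg (mul_nonneg hθ0 (by split_ifs <;> norm_num)) (sum_nonneg fun j _ => by split_ifs <;> norm_num), ?_⟩
  have h1 : θ * (if (0 : Fin (K + 1)) ∈ D then (1 : ℝ) else 0) ≤ θ := by
    split_ifs
    · rw [mul_one]
    · rw [mul_zero]; exact hθ0
  have h2 : ∑ j : Fin K, (if j.succ ∈ D then (1 : ℝ) else 0) ≤ K :=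
    calc ∑ j : Fin K, (if j.succ ∈ D then (1 : ℝ) else 0) ≤ ∑ _j : Fin K, (1 : ℝ) := sum_le_sum fun j _ => by split_ifs <;> norm_num
      _ = K := by rw [sum_const, card_univ, Fintype.card_fin, nsmul_eq_mul, mul_one]
  linarith

/-- A non-empty stale set has potential `≥ θ` (`0 ≤ θ ≤ 1`). [ours] -/
theorem stalePotential_ge_of_nonempty {θ : ℝ} (hθ0 : 0 ≤ θ) (hθ1 : θ ≤ 1) {Ψ : Finset (Fin (K + 1)) → ℝ}
    (hΨ : ∀ D, Ψ D = ∑ k : Fin (K + 1), (if k = 0 then θ else 1) * (if k ∈ D then (1 : ℝ) else 0))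
    {D : Finset (Fin (K + 1))} (hD : D ≠ ∅) : θ ≤ Ψ D := by
  obtain ⟨k, hk⟩ := Finset.nonempty_iff_ne_empty.mpr hD
  rw [hΨ]
  calc θ ≤ (if k = 0 then θ else 1) * (if k ∈ D then (1 : ℝ) else 0) := by
        rw [if_pos hk, mul_one]; split_ifs; exacts [le_rfl, hθ1]
    _ ≤ ∑ k : Fin (K + 1), (if k = 0 then θ else 1) * (if k ∈ D then (1 : ℝ) else 0) :=
        Finset.single_le_sum (f := fun k : Fin (K + 1) => (if k = 0 then θ else 1) * (if k ∈ D then (1 : ℝ) else 0))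
          (fun j _ => mul_nonneg (by split_ifs <;> linarith) (by split_ifs <;> norm_num)) (mem_univ k)

/-- The hot/cold form: `Ψ(D) = θ𝟙{0∈D} + #{j : j+1 ∈ D}`. [ours] -/
theorem stalePotential_eq_hub_add_cold {θ : ℝ} {Ψ : Finset (Fin (K + 1)) → ℝ}
    (hΨ : ∀ D, Ψ D = ∑ k : Fin (K + 1), (if k = 0 then θ else 1) * (if k ∈ D then (1 : ℝ) else 0))
    (D : Finset (Fin (K + 1))) :
    Ψ D = θ * (if (0 : Fin (K + 1)) ∈ D then (1 : ℝ) else 0) + ∑ j : Fin K, (if j.succ ∈ D then (1 : ℝ) else 0) := by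
  rw [hΨ, Fin.sum_univ_succ, if_pos rfl]
  simp_rw [if_neg (Fin.succ_ne_zero _), one_mul]

/-- `Σ_r 𝟙{κ_r+1 ∈ D} ≥ c·#{j : j+1 ∈ D}` (every cold level listed `≥ c` times). [ours] -/
theorem sum_entries_stale_ge {c : ℕ} (hc : ∀ p' : Fin K, c ≤ (univ.filter (fun r : Fin m => κ r = p')).card)
    (D : Finset (Fin (K + 1))) :
    (c : ℝ) * ∑ j : Fin K, (if j.succ ∈ D then (1 : ℝ) else 0) ≤ ∑ r : Fin m, (if (κ r).succ ∈ D then (1 : ℝ) else 0) := by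
  rw [← Finset.sum_fiberwise univ κ (fun r : Fin m => if (κ r).succ ∈ D then (1 : ℝ) else 0), Finset.mul_sum]
  refine sum_le_sum fun j _ => ?_
  rw [Finset.sum_congr rfl fun r hr => by rw [(Finset.mem_filter.mp hr).2], sum_const, nsmul_eq_mul]
  exact mul_le_mul_of_nonneg_right (by exact_mod_cast hc j) (by split_ifs <;> norm_num)

/-- **THE STALE POTENTIAL CONTRACTS:** `Σ_b P̂(a,b)·Ψ(b.2) ≤ (1−λ)·Ψ(a.2)` with
**`λ = min{(1−θ)·a·c·t/m, ((1−t)w_0·θ − (1−θ)t)/(K+θ)}`** (acceptance floor `a ≥ 0`, hub multiplicities `≥ c`, `0 < θ ≤ 1`,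
`(1−θ)t ≤ (1−t)w_0θ`, `t ≥ 0`, `Σw = 1`, `M_k` row-stochastic): a stale cold unit is offered to the hub at rate `≥ ct/m` and accepted with probability `≥ a`
(worth `θ` there instead of `1`); a stale hub unit escapes at rate `≤ t` (gain `1−θ`) and dies at the redraw (rate `(1−t)w_0`, loss `θ`). [ours] -/
theorem sectorAug_step_stalePotential_le (hm : 1 ≤ m) (ht0 : 0 ≤ t) (hw1 : ∑ k, w k = 1)
    (hM : ∀ k, IsRowStochastic (M k)) (hμ : ∀ k x, 0 < μ k x)
    {α : Fin m → (Fin (K + 1) → S) → ℝ}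
    (hα : ∀ r z, α r z = min 1 (tensorFun μ (edgeFlowSwap (φ r) 0 (κ r).succ z) / tensorFun μ z))
    {a : ℝ} (ha0 : 0 ≤ a) (ha : ∀ r z, a ≤ α r z) {θ : ℝ} (hθ0 : 0 < θ) (hθ1 : θ ≤ 1) (hreg : (1 - θ) * t ≤ (1 - t) * w 0 * θ)
    {c : ℕ} (hc : ∀ p' : Fin K, c ≤ (univ.filter (fun r : Fin m => κ r = p')).card)
    {Ψ : Finset (Fin (K + 1)) → ℝ}
    (hΨ : ∀ D, Ψ D = ∑ k : Fin (K + 1), (if k = 0 then θ else 1) * (if k ∈ D then (1 : ℝ) else 0))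
    {Ph : (Fin (K + 1) → S) × Finset (Fin (K + 1)) → (Fin (K + 1) → S) × Finset (Fin (K + 1)) → ℝ}
    (hPh : ∀ a b, Ph a b = ∑ r : Fin m, t / m *
        ((fun r a => α r a.1) r a * (if b.1 = edgeFlowSwap (φ r) 0 (κ r).succ a.1
            ∧ b.2 = a.2.image (Equiv.swap (0 : Fin (K + 1)) (κ r).succ) then (1 : ℝ) else 0)
          + (α r a.1 - (fun r a => α r a.1) r a) * (if b.1 = edgeFlowSwap (φ r) 0 (κ r).succ a.1
            ∧ b.2 = (fun (_ : Fin m) (D : Finset (Fin (K + 1))) => D) r a.2 then (1 : ℝ) else 0)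
          + (1 - α r a.1) * (if b.1 = a.1 ∧ b.2 = (fun (_ : Fin m) (D : Finset (Fin (K + 1))) => D) r a.2 then (1 : ℝ) else 0))
      + (1 - t) * ∑ k : Fin (K + 1), w k * (coordKernel M k a.1 b.1
          * (if b.2 = (if k = 0 then a.2.erase 0 else a.2) then (1 : ℝ) else 0)))
    (a₀ : (Fin (K + 1) → S) × Finset (Fin (K + 1))) :
    ∑ b, Ph a₀ b * Ψ b.2 ≤ (1 - min ((1 - θ) * a * c * t / m) (((1 - t) * w 0 * θ - (1 - θ) * t) / (K + θ))) * Ψ a₀.2 := by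
  obtain ⟨z, D⟩ := a₀
  have hmpos : (0 : ℝ) < m := Nat.cast_pos.mpr (by omega)
  have hacc := accept_mem κ φ hμ hα
  obtain ⟨hΨ0, hΨK⟩ := stalePotential_le hθ0.le hΨ D
  set lam := min ((1 - θ) * a * c * t / m) (((1 - t) * w 0 * θ - (1 - θ) * t) / (K + θ)) with hlam
  have hlam0 : 0 ≤ lam := le_min (by positivity) (div_nonneg (by linarith) (by positivity))
  -- the expected potential after one step, in closed form
  have hcK : ∀ k : Fin (K + 1), ∑ b1 : Fin (K + 1) → S, coordKernel M k z b1 = 1 := fun k => by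
    have h := sum_coordKernel_mul M k z (fun _ => (1 : ℝ)); simp only [mul_one] at h; rw [h, (hM k).2]
  have hI : ∀ (y : Fin (K + 1) → S) (E : Finset (Fin (K + 1))),
      ∑ b : (Fin (K + 1) → S) × Finset (Fin (K + 1)), (if b.1 = y ∧ b.2 = E then (1 : ℝ) else 0) * Ψ b.2 = Ψ E := by
    intro y E
    rw [Finset.sum_eq_single (y, E)]
    · simp
    · rintro b - hb; rw [if_neg, zero_mul]; rintro ⟨h1, h2⟩; exact hb (Prod.ext h1 h2)
    · intro h; exact absurd (mem_univ _) h
  have hJ : ∀ (k : Fin (K + 1)) (E : Finset (Fin (K + 1))),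
      ∑ b : (Fin (K + 1) → S) × Finset (Fin (K + 1)), (coordKernel M k z b.1 * (if b.2 = E then (1 : ℝ) else 0)) * Ψ b.2 = Ψ E := by
    intro k E
    rw [Fintype.sum_prod_type]
    simp_rw [mul_assoc, ← Finset.mul_sum, ite_mul, one_mul, zero_mul, Finset.sum_ite_eq' univ E, if_pos (mem_univ _)]
    rw [← Finset.sum_mul, hcK k, one_mul]
  have hexp : ∑ b, Ph (z, D) b * Ψ b.2
      = ∑ r : Fin m, t / m * (α r z * Ψ (D.image (Equiv.swap (0 : Fin (K + 1)) (κ r).succ)) + (1 - α r z) * Ψ D)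
        + ∑ k : Fin (K + 1), ((1 - t) * w k) * Ψ (if k = 0 then D.erase 0 else D) := by
    have hsplit : ∑ b, Ph (z, D) b * Ψ b.2
        = ∑ b : (Fin (K + 1) → S) × Finset (Fin (K + 1)), (∑ r : Fin m, t / m *
            (α r z * (if b.1 = edgeFlowSwap (φ r) 0 (κ r).succ z ∧ b.2 = D.image (Equiv.swap (0 : Fin (K + 1)) (κ r).succ)
                then (1 : ℝ) else 0)
              + (1 - α r z) * (if b.1 = z ∧ b.2 = D then (1 : ℝ) else 0))) * Ψ b.2
          + ∑ b : (Fin (K + 1) → S) × Finset (Fin (K + 1)), (∑ k : Fin (K + 1), ((1 - t) * w k) *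
            (coordKernel M k z b.1 * (if b.2 = (if k = 0 then D.erase 0 else D) then (1 : ℝ) else 0))) * Ψ b.2 := by
      rw [← Finset.sum_add_distrib]
      refine sum_congr rfl fun b _ => ?_
      rw [hPh, ← add_mul]
      dsimp only
      congr 2
      · exact sum_congr rfl fun r _ => by ring
      · rw [Finset.mul_sum]; exact sum_congr rfl fun k _ => by ring
    rw [hsplit, sum_mixture_mul, sum_mixture_mul]
    congr 1
    · refine sum_congr rfl fun r _ => ?_
      congr 1
      simp_rw [add_mul, Finset.sum_add_distrib, mul_assoc, ← Finset.mul_sum, hI]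
    · refine sum_congr rfl fun k _ => ?_
      rw [hJ]
  rw [hexp]
  -- the update part: `Σ_k (1−t)w_k Ψ(τ_k D) = (1−t)(Ψ(D) − w_0 θ 𝟙{0∈D})`
  have hupd : ∑ k : Fin (K + 1), ((1 - t) * w k) * Ψ (if k = 0 then D.erase 0 else D)
      = (1 - t) * Ψ D - (1 - t) * w 0 * θ * (if (0 : Fin (K + 1)) ∈ D then (1 : ℝ) else 0) := by
    rw [Fin.sum_univ_succ, if_pos rfl, stalePotential_erase hΨ]
    simp_rw [if_neg (Fin.succ_ne_zero _)]
    have hw : w 0 + ∑ j : Fin K, w j.succ = 1 := by rw [← Fin.sum_univ_succ]; exact hw1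
    rw [← Finset.sum_mul]
    have : ∑ j : Fin K, (1 - t) * w j.succ = (1 - t) * (1 - w 0) := by rw [← Finset.mul_sum]; congr 1; linarith
    rw [this]; ring
  rw [hupd]
  have htsum : ∑ _r : Fin m, t / m * Ψ D = t * Ψ D := by rw [sum_const, card_univ, Fintype.card_fin, nsmul_eq_mul]; field_simp
  by_cases h0 : (0 : Fin (K + 1)) ∈ D
  · -- the hub is stale: escape at rate `≤ t`, death at rate `(1−t)w_0`
    have hswap : ∀ r : Fin m, α r z * Ψ (D.image (Equiv.swap (0 : Fin (K + 1)) (κ r).succ)) + (1 - α r z) * Ψ D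
        ≤ Ψ D + (1 - θ) := by
      intro r
      rw [stalePotential_swap κ hΨ r D, if_pos h0]
      have h1 : (if (κ r).succ ∈ D then (1 : ℝ) else 0) ≤ 1 := by split_ifs <;> norm_num
      have h2 : 0 ≤ (if (κ r).succ ∈ D then (1 : ℝ) else 0) := by split_ifs <;> norm_num
      have hai : α r z * (1 - (if (κ r).succ ∈ D then (1 : ℝ) else 0)) ≤ 1 := by
        calc α r z * (1 - (if (κ r).succ ∈ D then (1 : ℝ) else 0)) ≤ 1 * 1 :=
              mul_le_mul (hacc r z).2 (by linarith) (by linarith) zero_le_one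
          _ = 1 := one_mul 1
      have key : α r z * (Ψ D + θ * ((if (κ r).succ ∈ D then (1 : ℝ) else 0) - 1) + (1 - (if (κ r).succ ∈ D then (1 : ℝ) else 0)))
          + (1 - α r z) * Ψ D = Ψ D + (α r z * (1 - (if (κ r).succ ∈ D then (1 : ℝ) else 0))) * (1 - θ) := by ring
      rw [key]
      nlinarith [mul_le_mul_of_nonneg_right hai (sub_nonneg.mpr hθ1)]
    have h1 : ∑ r : Fin m, t / m * (α r z * Ψ (D.image (Equiv.swap (0 : Fin (K + 1)) (κ r).succ)) + (1 - α r z) * Ψ D)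
        ≤ t * Ψ D + t * (1 - θ) := by
      calc _ ≤ ∑ _r : Fin m, t / m * (Ψ D + (1 - θ)) := sum_le_sum fun r _ => mul_le_mul_of_nonneg_left (hswap r) (by positivity)
        _ = t * Ψ D + t * (1 - θ) := by rw [sum_const, card_univ, Fintype.card_fin, nsmul_eq_mul]; field_simp
    rw [if_pos h0, mul_one]
    have hmin : lam ≤ ((1 - t) * w 0 * θ - (1 - θ) * t) / (K + θ) := min_le_right _ _
    have hlamK : lam * Ψ D ≤ (1 - t) * w 0 * θ - (1 - θ) * t := by
      calc lam * Ψ D ≤ lam * (θ + K) := mul_le_mul_of_nonneg_left hΨK hlam0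
        _ ≤ ((1 - t) * w 0 * θ - (1 - θ) * t) / (K + θ) * (θ + K) := mul_le_mul_of_nonneg_right hmin (by positivity)
        _ = (1 - t) * w 0 * θ - (1 - θ) * t := by field_simp; ring
    linarith [h1, hlamK]
  · -- the hub is fresh: every stale cold unit is pushed to the hub
    have hhub := stalePotential_eq_hub_add_cold hΨ D
    rw [if_neg h0, mul_zero, zero_add] at hhub
    have hswap : ∀ r : Fin m, α r z * Ψ (D.image (Equiv.swap (0 : Fin (K + 1)) (κ r).succ)) + (1 - α r z) * Ψ D
        ≤ Ψ D - (1 - θ) * a * (if (κ r).succ ∈ D then (1 : ℝ) else 0) := by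
      intro r
      rw [stalePotential_swap κ hΨ r D, if_neg h0]
      have h2 : 0 ≤ (if (κ r).succ ∈ D then (1 : ℝ) else 0) := by split_ifs <;> norm_num
      nlinarith [ha r z, sub_nonneg.mpr hθ1, mul_nonneg (sub_nonneg.mpr hθ1) h2]
    have hcnt := sum_entries_stale_ge κ hc D
    have h1 : ∑ r : Fin m, t / m * (α r z * Ψ (D.image (Equiv.swap (0 : Fin (K + 1)) (κ r).succ)) + (1 - α r z) * Ψ D)
        ≤ t * Ψ D - t / m * ((1 - θ) * a) * ∑ r : Fin m, (if (κ r).succ ∈ D then (1 : ℝ) else 0) := by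
      calc _ ≤ ∑ r : Fin m, (t / m * Ψ D - t / m * ((1 - θ) * a) * (if (κ r).succ ∈ D then (1 : ℝ) else 0)) :=
            sum_le_sum fun r _ => by
              have := mul_le_mul_of_nonneg_left (hswap r) (show (0 : ℝ) ≤ t / m by positivity); linarith
        _ = _ := by rw [Finset.sum_sub_distrib, htsum, ← Finset.mul_sum]
    have hD : (1 - θ) * a * c * t / m * Ψ D ≤ t / m * ((1 - θ) * a) * ∑ r : Fin m, (if (κ r).succ ∈ D then (1 : ℝ) else 0) := by
      have h := mul_le_mul_of_nonneg_left hcnt (show (0 : ℝ) ≤ (1 - θ) * a * (t / m) by positivity)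
      calc (1 - θ) * a * c * t / m * Ψ D = (1 - θ) * a * (t / m) * (c * Ψ D) := by ring
        _ = (1 - θ) * a * (t / m) * (c * ∑ j : Fin K, (if j.succ ∈ D then (1 : ℝ) else 0)) := by rw [← hhub]
        _ ≤ (1 - θ) * a * (t / m) * ∑ r : Fin m, (if (κ r).succ ∈ D then (1 : ℝ) else 0) := h
        _ = _ := by ring
    rw [if_neg h0, mul_zero, sub_zero]
    have hmin : lam ≤ (1 - θ) * a * c * t / m := min_le_left _ _
    have hlamΨ : lam * Ψ D ≤ (1 - θ) * a * c * t / m * Ψ D := mul_le_mul_of_nonneg_right hmin hΨ0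
    linarith [h1, hD, hlamΨ]

/-- **THE PRIMORDIAL CONTENT DISAPPEARS GEOMETRICALLY:** from `δ_{(x, univ)}`,
**`Σ_{(z,D) : D ≠ ∅} λ̂_n(z,D) ≤ ((θ+K)/θ)·(1 − λ)ⁿ`** (`λ` as above; `m ≥ 1`, `0 ≤ t ≤ 1`, `w` a probability vector). [ours] -/
theorem sectorAug_stale_le (hm : 1 ≤ m) (ht0 : 0 ≤ t) (ht1 : t ≤ 1) (hw0 : ∀ k, 0 ≤ w k) (hw1 : ∑ k, w k = 1)
    (hM : ∀ k, IsRowStochastic (M k)) (hμ : ∀ k x, 0 < μ k x)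
    {α : Fin m → (Fin (K + 1) → S) → ℝ}
    (hα : ∀ r z, α r z = min 1 (tensorFun μ (edgeFlowSwap (φ r) 0 (κ r).succ z) / tensorFun μ z))
    {a : ℝ} (ha0 : 0 ≤ a) (ha : ∀ r z, a ≤ α r z) {θ : ℝ} (hθ0 : 0 < θ) (hθ1 : θ ≤ 1) (hreg : (1 - θ) * t ≤ (1 - t) * w 0 * θ)
    {c : ℕ} (hc : ∀ p' : Fin K, c ≤ (univ.filter (fun r : Fin m => κ r = p')).card)
    {Ph : (Fin (K + 1) → S) × Finset (Fin (K + 1)) → (Fin (K + 1) → S) × Finset (Fin (K + 1)) → ℝ}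
    (hPh : ∀ a b, Ph a b = ∑ r : Fin m, t / m *
        ((fun r a => α r a.1) r a * (if b.1 = edgeFlowSwap (φ r) 0 (κ r).succ a.1
            ∧ b.2 = a.2.image (Equiv.swap (0 : Fin (K + 1)) (κ r).succ) then (1 : ℝ) else 0)
          + (α r a.1 - (fun r a => α r a.1) r a) * (if b.1 = edgeFlowSwap (φ r) 0 (κ r).succ a.1
            ∧ b.2 = (fun (_ : Fin m) (D : Finset (Fin (K + 1))) => D) r a.2 then (1 : ℝ) else 0)
          + (1 - α r a.1) * (if b.1 = a.1 ∧ b.2 = (fun (_ : Fin m) (D : Finset (Fin (K + 1))) => D) r a.2 then (1 : ℝ) else 0))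
      + (1 - t) * ∑ k : Fin (K + 1), w k * (coordKernel M k a.1 b.1
          * (if b.2 = (if k = 0 then a.2.erase 0 else a.2) then (1 : ℝ) else 0)))
    (x : Fin (K + 1) → S) (n : ℕ) :
    ∑ b ∈ univ.filter (fun b : (Fin (K + 1) → S) × Finset (Fin (K + 1)) => b.2 ≠ ∅),
        lawAt Ph (Pi.single (x, (univ : Finset (Fin (K + 1)))) 1) n b
      ≤ (θ + K) / θ * (1 - min ((1 - θ) * a * c * t / m) (((1 - t) * w 0 * θ - (1 - θ) * t) / (K + θ))) ^ n := by
  set lam := min ((1 - θ) * a * c * t / m) (((1 - t) * w 0 * θ - (1 - θ) * t) / (K + θ)) with hlam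
  set Ψ : Finset (Fin (K + 1)) → ℝ := fun D => ∑ k : Fin (K + 1), (if k = 0 then θ else 1) * (if k ∈ D then (1 : ℝ) else 0) with hΨd
  have hΨ : ∀ D, Ψ D = ∑ k : Fin (K + 1), (if k = 0 then θ else 1) * (if k ∈ D then (1 : ℝ) else 0) := fun D => rfl
  have hPs := sectorAug_isRowStochastic κ φ hm ht0 ht1 hw0 hw1 hM hμ hα hPh
  have hstep := sectorAug_step_stalePotential_le κ φ hm ht0 hw1 hM hμ hα ha0 ha hθ0 hθ1 hreg hc hΨ hPh
  have hlam1 : 0 ≤ 1 - lam := by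
    have h2 : lam ≤ ((1 - t) * w 0 * θ - (1 - θ) * t) / (K + θ) := min_le_right _ _
    have h3 : ((1 - t) * w 0 * θ - (1 - θ) * t) / (K + θ) ≤ 1 := by
      rw [div_le_one (by positivity)]
      have hw01 : w 0 ≤ 1 := by
        calc w 0 ≤ ∑ k, w k := Finset.single_le_sum (fun k _ => hw0 k) (mem_univ 0)
          _ = 1 := hw1
      nlinarith [mul_nonneg (sub_nonneg.mpr ht1) (hw0 0), mul_nonneg (sub_nonneg.mpr hθ1) ht0, hθ0.le,
        mul_le_mul_of_nonneg_left hw01 (sub_nonneg.mpr ht1), Nat.cast_nonneg (α := ℝ) K]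
    linarith
  have hdecay : ∑ b, lawAt Ph (Pi.single (x, (univ : Finset (Fin (K + 1)))) 1) n b * Ψ b.2 ≤ (1 - lam) ^ n * Ψ univ := by
    have h := lawMean_lawAt_le_of_step_le hPs hlam1 (Φ := fun b => Ψ b.2) hstep (μ := Pi.single (x, (univ : Finset (Fin (K + 1)))) 1)
      (fun a => by rw [Pi.single_apply]; split_ifs <;> norm_num) n
    rw [lawMean_single] at h
    exact h
  have hL0 : ∀ b, 0 ≤ lawAt Ph (Pi.single (x, (univ : Finset (Fin (K + 1)))) 1) n b :=
    fun b => lawAt_nonneg hPs (fun a => by rw [Pi.single_apply]; split_ifs <;> norm_num) n b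
  obtain ⟨-, hΨK⟩ := stalePotential_le hθ0.le hΨ (univ : Finset (Fin (K + 1)))
  calc ∑ b ∈ univ.filter (fun b : (Fin (K + 1) → S) × Finset (Fin (K + 1)) => b.2 ≠ ∅),
          lawAt Ph (Pi.single (x, (univ : Finset (Fin (K + 1)))) 1) n b
      ≤ ∑ b ∈ univ.filter (fun b : (Fin (K + 1) → S) × Finset (Fin (K + 1)) => b.2 ≠ ∅),
          lawAt Ph (Pi.single (x, (univ : Finset (Fin (K + 1)))) 1) n b * (Ψ b.2 / θ) :=
        sum_le_sum fun b hb => by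
          have hne : b.2 ≠ ∅ := (Finset.mem_filter.mp hb).2
          have h1 : 1 ≤ Ψ b.2 / θ := by rw [le_div_iff₀ hθ0, one_mul]; exact stalePotential_ge_of_nonempty hθ0.le hθ1 hΨ hne
          simpa only [mul_one] using mul_le_mul_of_nonneg_left h1 (hL0 b)
    _ ≤ ∑ b, lawAt Ph (Pi.single (x, (univ : Finset (Fin (K + 1)))) 1) n b * (Ψ b.2 / θ) :=
        sum_le_sum_of_subset_of_nonneg (filter_subset _ _) fun b _ _ =>
          mul_nonneg (hL0 b) (div_nonneg (stalePotential_le hθ0.le hΨ b.2).1 hθ0.le)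
    _ = (∑ b, lawAt Ph (Pi.single (x, (univ : Finset (Fin (K + 1)))) 1) n b * Ψ b.2) / θ := by
        rw [Finset.sum_div]; exact sum_congr rfl fun b _ => by ring
    _ ≤ (1 - lam) ^ n * Ψ univ / θ := div_le_div_of_nonneg_right hdecay hθ0.le
    _ ≤ (1 - lam) ^ n * (θ + K) / θ := div_le_div_of_nonneg_right (mul_le_mul_of_nonneg_left hΨK (pow_nonneg hlam1 n)) hθ0.le
    _ = (θ + K) / θ * (1 - lam) ^ n := by ring

end StaleSet

end Summit.Ventures.LatticeQCDFlow.Scaling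

end
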